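import Literature.Computability.AlgebraicComplexity.SymbolicMatrixDecomposition

/-!
# Crux `RankOneTrivialisation` (stmt-ValiantsHypothesis-5667), line `nagata-multilinear-chart` —
stub 3 `stub_degreeBudget_mod_homogeneous_prime`: the degree budget modulo a homogeneous prime

Generic graded bookkeeping (any field `K`, any index type `σ`, any homogeneous PRIME form `f`, any
entrywise degree bound `D`): if a square matrix `B` with `deg B_ij ≤ D` is an outer product modulo
`f`, `B ≡ c' w'ᵀ (mod f)`, then the factors can be re-chosen with `deg cᵢ ≤ dc`, `deg wⱼ ≤ dw` and
`dc + dw ≤ D`, still `B ≡ c wᵀ (mod f)`.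

Proof (engine `outerProduct_degree_trim`).  Replace every `c'ᵢ`, `w'ⱼ` by a representative of
minimal total degree of its class modulo `(f)` (`exists_minimal_rep`); the classes, hence the
congruence `B ≡ c wᵀ (mod f)`, are unchanged.  Put `dc := max deg cᵢ`, `dw := max deg wⱼ`.  If
`dc + dw ≤ D` we are done.  Otherwise, for all `i, j` the degree-`(dc + dw)` component of
`B_ij - cᵢ wⱼ ∈ (f)` lies in `(f)` (the principal ideal of a form is a homogeneous ideal,
`homogeneousComponent_mem_span`); the component of `B_ij` vanishes (`deg B_ij ≤ D < dc + dw`) and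
the component of `cᵢ wⱼ` is `(cᵢ)_dc · (wⱼ)_dw` (top components multiply, tree lemma
`homogeneousComponent_mul_of_totalDegree_le`).  As `(f)` is prime, `(cᵢ)_dc ∈ (f)` or
`(wⱼ)_dw ∈ (f)` for every pair `(i, j)`, so either all `(cᵢ)_dc ∈ (f)` or all `(wⱼ)_dw ∈ (f)`.
But a non-zero representative of minimal degree has its top component outside `(f)`
(`top_notMem_of_minimal`: subtracting the top component would lower the degree inside the class;
in degree `0` a non-zero constant in `(f)` would make `f` a unit), so the whole vector `c` (or `w`)
lies in `(f)` (`all_mem_of_top_mem`), i.e. `B ≡ 0 (mod f)`, and `c = w = 0`, `dc = dw = 0` works.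

The budget `D` in the conclusion is sharp (no bound `< D` holds in general: the twisted Grenet
matrix `Bpp` of the crux disprover, `B = adj Bpp`, `D = m - 1 = 6`, needs `dc + dw = 6`).
-/

noncomputable section

namespace Summit.ValiantsHypothesis.Theorems.RankOneTrivialisation

open MvPolynomial Matrix
open Literature.Computability.AlgebraicComplexity

-- adapted from Cruxes/RankOneTrivialisation/Disproof.lean §DegreeBudget
-- (refuter-cdisprove-stmt-ValiantsHypothesis-5667-g2)

section DegreeBudget

variable {K : Type*} [Field K] {σ : Type*}

/-- Homogeneous components of a multiple `φ ψ` of a form `φ` are multiples of that form: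
`(φ ψ)_d = φ · ψ_{d - deg φ}` (or `0`). [folklore] -/
theorem homogeneousComponent_mul_mem_span {φ : MvPolynomial σ K} {k : ℕ}
    (hφ : φ.IsHomogeneous k) (ψ : MvPolynomial σ K) (d : ℕ) :
    homogeneousComponent d (φ * ψ) ∈ Ideal.span {φ} := by
  have hψ : φ * ψ = ∑ j ∈ Finset.range (ψ.totalDegree + 1), φ * homogeneousComponent j ψ := by
    rw [← Finset.mul_sum, sum_homogeneousComponent]
  rw [hψ, map_sum]
  refine Ideal.sum_mem _ fun j _ => ?_
  rw [homogeneousComponent_of_mem ((mem_homogeneousSubmodule _ _).2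
    (hφ.mul (homogeneousComponent_isHomogeneous j ψ)))]
  split_ifs
  · exact Ideal.mul_mem_right _ _ (Ideal.subset_span rfl)
  · exact Ideal.zero_mem _

/-- The principal ideal of a form `f` is homogeneous: it contains the homogeneous components of
each of its elements. [folklore] -/
theorem homogeneousComponent_mem_span {f : MvPolynomial σ K} {e : ℕ} (hf : f.IsHomogeneous e)
    {g : MvPolynomial σ K} (hg : g ∈ Ideal.span {f}) (d : ℕ) :
    homogeneousComponent d g ∈ Ideal.span {f} := by
  obtain ⟨q, rfl⟩ := Ideal.mem_span_singleton'.1 hg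
  rw [mul_comm]
  exact homogeneousComponent_mul_mem_span hf q d

/-- Every residue class modulo an ideal of a polynomial ring has a representative of minimal total
degree. [folklore] -/
theorem exists_minimal_rep (I : Ideal (MvPolynomial σ K)) (g : MvPolynomial σ K) :
    ∃ q : MvPolynomial σ K, g - q ∈ I ∧ ∀ q', q - q' ∈ I → q.totalDegree ≤ q'.totalDegree := by
  classical
  have hP : ∃ d, ∃ q, g - q ∈ I ∧ q.totalDegree ≤ d := ⟨_, g, by simp, le_rfl⟩
  obtain ⟨q, hq, hqd⟩ := Nat.find_spec hP
  refine ⟨q, hq, fun q' hqq' => hqd.trans (Nat.find_min' hP ⟨q', ?_, le_rfl⟩)⟩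
  have := I.add_mem hq hqq'
  rwa [sub_add_sub_cancel] at this

/-- A non-zero representative `q` of minimal total degree modulo a PRIME `f` has its top
homogeneous component outside `(f)` — otherwise subtracting it gives a representative of smaller
degree (or, in degree `0`, a non-zero constant in `(f)` would make `f` a unit). [folklore] -/
theorem top_notMem_of_minimal {f : MvPolynomial σ K} (hp : Prime f) {q : MvPolynomial σ K}
    (hmin : ∀ q', q - q' ∈ Ideal.span {f} → q.totalDegree ≤ q'.totalDegree) (hq0 : q ≠ 0) :
    homogeneousComponent q.totalDegree q ∉ Ideal.span {f} := by
  intro htop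
  by_cases hd : q.totalDegree = 0
  · rw [hd, homogeneousComponent_zero] at htop
    have ha : coeff 0 q ≠ 0 := by
      intro h0
      apply hq0
      rw [totalDegree_eq_zero_iff_eq_C.1 hd, h0, C_0]
    have hunit : IsUnit (C (coeff 0 q) : MvPolynomial σ K) := (isUnit_iff_ne_zero.2 ha).map C
    have htop' := Ideal.eq_top_of_isUnit_mem _ htop hunit
    exact hp.not_unit (Ideal.span_singleton_eq_top.1 htop')
  · set d := q.totalDegree with hd_def
    have hsum := sum_homogeneousComponent q
    rw [Finset.sum_range_succ] at hsum
    rw [← hd_def] at hsum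
    have hq' : q - ∑ i ∈ Finset.range d, homogeneousComponent i q = homogeneousComponent d q := by
      rw [sub_eq_iff_eq_add']
      exact hsum.symm
    have hle := hmin (∑ i ∈ Finset.range d, homogeneousComponent i q) (by rw [hq']; exact htop)
    have hlt : (∑ i ∈ Finset.range d, homogeneousComponent i q).totalDegree < d := by
      refine lt_of_le_of_lt (totalDegree_finsetSum_le fun i hi => ?_) (Nat.sub_one_lt hd)
      refine (homogeneousComponent_isHomogeneous i q).totalDegree_le.trans ?_
      rw [Finset.mem_range] at hi
      omega
    omega

/-- If the minimal representatives `q i` (modulo a prime `f`) all have their degree-`d` components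
in `(f)`, where `deg (q i) ≤ d` for all `i` with equality for some `i`, then all `q i ∈ (f)`.
[folklore] -/
theorem all_mem_of_top_mem {f : MvPolynomial σ K} (hp : Prime f) {m : ℕ}
    {q : Fin m → MvPolynomial σ K} {d : ℕ}
    (hmin : ∀ i q', q i - q' ∈ Ideal.span {f} → (q i).totalDegree ≤ q'.totalDegree)
    (hdeg : ∀ i, (q i).totalDegree ≤ d) (hex : ∃ i, (q i).totalDegree = d)
    (htop : ∀ i, homogeneousComponent d (q i) ∈ Ideal.span {f}) :
    ∀ i, q i ∈ Ideal.span {f} := by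
  obtain ⟨i₀, hi₀⟩ := hex
  by_cases h0 : q i₀ = 0
  · have hd0 : d = 0 := by rw [← hi₀, h0, totalDegree_zero]
    subst hd0
    intro i
    have hqi : q i = C (coeff 0 (q i)) := totalDegree_eq_zero_iff_eq_C.1 (Nat.le_zero.1 (hdeg i))
    rw [hqi, ← homogeneousComponent_zero]
    exact htop i
  · exact absurd (hi₀ ▸ htop i₀) (top_notMem_of_minimal hp (hmin i₀) h0)

/-- **The engine.** Modulo a homogeneous prime form `f`, an outer-product factorisation
`B ≡ c wᵀ (mod f)` of a square matrix `B` with `deg B_ij ≤ D` can be re-chosen with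
`deg c'ᵢ ≤ dc`, `deg w'ⱼ ≤ dw`, `dc + dw ≤ D`: pass to minimal-degree representatives; if then
`dc + dw > D`, the degree-`(dc + dw)` components `(cᵢ)_dc (wⱼ)_dw` all lie in the prime `(f)`, so a
whole vector of top components lies in `(f)`, forcing that vector to be `≡ 0` (minimality), and
`c' = w' = 0` works. [folklore] -/
theorem outerProduct_degree_trim {f : MvPolynomial σ K} {e : ℕ} (hf : f.IsHomogeneous e)
    (hp : Prime f) {m D : ℕ} (B : Matrix (Fin m) (Fin m) (MvPolynomial σ K))
    (hB : ∀ i j, (B i j).totalDegree ≤ D) (c w : Fin m → MvPolynomial σ K)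
    (h : ∀ i j, B i j - c i * w j ∈ Ideal.span {f}) :
    ∃ (c' w' : Fin m → MvPolynomial σ K) (dc dw : ℕ), dc + dw ≤ D ∧
      (∀ i, (c' i).totalDegree ≤ dc) ∧ (∀ i, (w' i).totalDegree ≤ dw) ∧
      ∀ i j, B i j - c' i * w' j ∈ Ideal.span {f} := by
  classical
  set I := Ideal.span {f}
  have hIprime : I.IsPrime := (Ideal.span_singleton_prime hp.ne_zero).mpr hp
  rcases Nat.eq_zero_or_pos m with rfl | hm
  · exact ⟨c, w, 0, 0, by omega, fun i => Fin.elim0 i, fun i => Fin.elim0 i, fun i => Fin.elim0 i⟩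
  haveI : Nonempty (Fin m) := ⟨⟨0, hm⟩⟩
  choose q hq using fun i => exists_minimal_rep I (c i)
  choose r hr using fun j => exists_minimal_rep I (w j)
  -- the congruence survives the change of representatives
  have hBqr : ∀ i j, B i j - q i * r j ∈ I := by
    intro i j
    have h1 : c i * w j - q i * r j ∈ I := by
      have := I.add_mem (I.mul_mem_right (w j) (hq i).1) (I.mul_mem_left (q i) (hr j).1)
      convert this using 1
      ring
    have := I.add_mem (h i j) h1
    rwa [sub_add_sub_cancel] at this
  set dc := Finset.univ.sup fun i => (q i).totalDegree
  set dw := Finset.univ.sup fun j => (r j).totalDegree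
  have hqdeg : ∀ i, (q i).totalDegree ≤ dc := fun i =>
    Finset.le_sup (f := fun i => (q i).totalDegree) (Finset.mem_univ i)
  have hrdeg : ∀ j, (r j).totalDegree ≤ dw := fun j =>
    Finset.le_sup (f := fun j => (r j).totalDegree) (Finset.mem_univ j)
  by_cases hsum : dc + dw ≤ D
  · exact ⟨q, r, dc, dw, hsum, hqdeg, hrdeg, hBqr⟩
  rw [not_le] at hsum
  -- over budget: a whole vector of minimal representatives is `≡ 0`, so `B ≡ 0`
  suffices hall : (∀ i, q i ∈ I) ∨ (∀ j, r j ∈ I) by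
    refine ⟨0, 0, 0, 0, by omega, fun i => by simp, fun i => by simp, fun i j => ?_⟩
    simp only [Pi.zero_apply, mul_zero, sub_zero]
    have hqr : q i * r j ∈ I :=
      hall.elim (fun h' => I.mul_mem_right _ (h' i)) (fun h' => I.mul_mem_left _ (h' j))
    have := I.add_mem (hBqr i j) hqr
    rwa [sub_add_cancel] at this
  -- top components multiply into the homogeneous prime `(f)`
  have key : ∀ i j, homogeneousComponent dc (q i) ∈ I ∨ homogeneousComponent dw (r j) ∈ I := by
    intro i j
    have hc := homogeneousComponent_mem_span hf (hBqr i j) (dc + dw)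
    rw [map_sub, homogeneousComponent_eq_zero _ _ (lt_of_le_of_lt (hB i j) hsum), zero_sub,
      homogeneousComponent_mul_of_totalDegree_le _ _ (hqdeg i) (hrdeg j), neg_mem_iff] at hc
    exact hIprime.mem_or_mem hc
  obtain ⟨i₀, -, hi₀⟩ := Finset.exists_mem_eq_sup Finset.univ Finset.univ_nonempty
    fun i => (q i).totalDegree
  obtain ⟨j₀, -, hj₀⟩ := Finset.exists_mem_eq_sup Finset.univ Finset.univ_nonempty
    fun j => (r j).totalDegree
  by_cases hq' : ∀ i, homogeneousComponent dc (q i) ∈ I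
  · exact Or.inl (all_mem_of_top_mem hp (fun i => (hq i).2) hqdeg ⟨i₀, hi₀.symm⟩ hq')
  · push Not at hq'
    obtain ⟨i₁, hi₁⟩ := hq'
    exact Or.inr (all_mem_of_top_mem hp (fun j => (hr j).2) hrdeg ⟨j₀, hj₀.symm⟩
      fun j => (key i₁ j).resolve_left hi₁)

end DegreeBudget

/-- **Stub 3 of line `nagata-multilinear-chart` (= stub 4 of the sibling line `pic-not-cl`):
the degree budget modulo a homogeneous prime.**  Let `f ∈ K[σ]` be a prime form (homogeneous of
some degree `e`), `B` an `m × m` matrix with all entries of total degree `≤ D`, and suppose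
`B ≡ c' w'ᵀ (mod f)` entrywise for SOME vectors `c', w'`.  Then there are `c, w` and `dc + dw ≤ D`
with `deg cᵢ ≤ dc`, `deg wⱼ ≤ dw` and still `B ≡ c wᵀ (mod f)` — an instance of the engine
`outerProduct_degree_trim`. [folklore] -/
theorem stub_degreeBudget_mod_homogeneous_prime :
    ∀ (σ K : Type) [Field K] (f : MvPolynomial σ K) (e : ℕ), f.IsHomogeneous e → Prime f →
      ∀ (m D : ℕ) (B : Matrix (Fin m) (Fin m) (MvPolynomial σ K)),
        (∀ i j, (B i j).totalDegree ≤ D) →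
        ∀ (c' w' : Fin m → MvPolynomial σ K), (∀ i j, B i j - c' i * w' j ∈ Ideal.span {f}) →
          ∃ (c w : Fin m → MvPolynomial σ K) (dc dw : ℕ), dc + dw ≤ D ∧
            (∀ i, (c i).totalDegree ≤ dc) ∧ (∀ i, (w i).totalDegree ≤ dw) ∧
            ∀ i j, B i j - c i * w j ∈ Ideal.span {f} :=
  fun _ _ _ _ _ hf hp _ _ B hB c' w' h => outerProduct_degree_trim hf hp B hB c' w' h

end Summit.ValiantsHypothesis.Theorems.RankOneTrivialisation

end
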